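import Summits.FinalStateConjecture.FinalStateConjecture.Theorems.PhotonSphereChannelsChannelsResolveTameDevelopmentsRHullKretschmannBase
import Literature.Geometry.Lorentzian.CommonDevelopmentEmbedding
import Literature.Geometry.Lorentzian.Isometry
import HarnessLib

/-!
# Route PhotonSphereChannels · crux `ChannelsResolveTameDevelopmentsR` (K2R-T2, stmt-FinalStateConjecture-17430) ·
# line `tame-lasalle-dock` · stub N `stub_noExtremalShadow` (♭ form, Reshape 1d): the ♭ side condition is FREE on every
# element that is already classified (sub-extremal Kerr d.o.c., or flat)

Stub N in the ♭ form asks, for every silent hull element `(𝓢, E, p)` of a development as in Φ: every Kerr exterior `(M', a)`,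
`0 < M'`, `|a| ≤ M'`, mapped injectively and locally isometrically onto `E.doc` admits a SUB-EXTREMAL re-identification `(M₂, a₂)`,
`|a₂| < M₂`, mapped the same way onto `E.doc`. This file shows that the ♭ condition carries NO content on elements whose d.o.c. is
already known:

* `kerrExterior_of_isKerrDoc` — an EXACT Kerr d.o.c. `IsKerrDoc 𝓢 O M a` (zero Kerr–Schild deviation) is the image of an injective
  local isometry of the smooth Kerr exterior (the exact chart is an isometric immersion, hence a local diffeomorphism between
  4-manifolds — `LorentzianMetric.isLocalDiffeomorph_of_isIsometricImmersion`); the converse of G4 `isKerrDoc_of_isLocalIsometry`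
  up to the orientation clause;
* `noExtremalShadow_flat_of_isKerrDoc` — if `E.doc` IS a sub-extremal Kerr d.o.c., the ♭ condition holds (re-identify by the own
  chart) — whereas the un-flattened form `|a| < M'` would need "an extremal Kerr exterior is not isometric to a sub-extremal one",
  a slice of the parameter-uniqueness problem (U) of stub K♭;
* `not_kerrExterior_of_isMinkowski` — NO Kerr exterior of positive mass maps locally isometrically into a flat spacetime
  (Kretschmann: `0` for `IsMinkowski`, `48M²/r⁶ > 0` at an equatorial exterior point, transported by the isometric immersion);
  hence `noExtremalShadow_flat_of_isMinkowski` — the ♭ condition (indeed any condition with that antecedent) holds on flat elements.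

So what N really asks is: no silent hull element has an EXTREMAL-ONLY Kerr d.o.c. No route item is restated.

References: O'Neill 1983, Ch. 3, pp. 58, 90–91, Prop. 3.41 [ONeill1983]; Visser arXiv:0706.0622, §3 [arXiv07060622];
Dafermos–Luk 2017, Conjecture 1 [DafermosLuk2017].
-/

noncomputable section

-- the operator-norm instance on `E4 →L[ℝ] E4 →L[ℝ] ℝ` needs one more level of pending
-- instance problems than the default (as in `PhotonSphereChannelsTameHullDefs.lean`)
set_option maxSynthPendingDepth 3
-- every `Summit.FinalStateConjecture.FinalStateConjecture.…` name repeats the summit = sub-problem segment (D-0017 layout)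
set_option linter.dupNamespace false

open Set Filter Function TopologicalSpace Manifold Bundle
open scoped Topology Manifold ContDiff ENNReal NNReal

namespace Summit.FinalStateConjecture.FinalStateConjecture.Theorems.TameLaSalle

open Literature.Geometry.Lorentzian
open Summit.FinalStateConjecture.FinalStateConjecture.Theorems.TameHull
open Summit.FinalStateConjecture.FinalStateConjecture.Theorems.HullCurvature

/-- **An exact Kerr d.o.c. is a Kerr exterior up to orientation** (converse of G4 up to the orientation clause): the exact chart
`Ψ` of `IsKerrDoc 𝓢 O M a` (`Ψ^* g − g_{M,a} = 0`) is an isometric immersion of `(Kerr.exterior M a, Kerr.smoothMetric M a r₊)`,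
hence a local diffeomorphism (equidimensional, `LorentzianMetric.isLocalDiffeomorph_of_isIsometricImmersion`), i.e. an injective
local isometry onto `O`. O'Neill 1983, Ch. 3, p. 90. [cite: ONeill1983, Ch. 3, pp. 90–91] -/
theorem kerrExterior_of_isKerrDoc [Kerr.Facts] {𝓢 : Spacetime.{0} 4} {O : Set 𝓢.carrier} {M a : ℝ}
    (h : IsKerrDoc 𝓢 O M a) (hM : 0 ≤ M) :
    ∃ Ψ : Kerr.exterior M a → 𝓢.carrier, Function.Injective Ψ ∧ Set.range Ψ = O ∧
      PseudoRiemannianMetric.IsLocalIsometry (Kerr.smoothMetric M a (Kerr.rPlus M a)).toPseudoRiemannianMetric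
        𝓢.metric.toPseudoRiemannianMetric Ψ := by
  obtain ⟨Ψ, hinj, hsmooth, hrange, hdev, -⟩ := h
  have hE : (Kerr.spacetime M a (Kerr.rPlus M a) hM).metric.IsIsometricImmersion
      𝓢.metric.toPseudoRiemannianMetric Ψ := by
    refine ⟨hsmooth, fun z ↦ ?_⟩
    have hz := hdev z
    rw [Spacetime.deviation, sub_eq_zero] at hz
    exact hz
  exact ⟨Ψ, hinj, hrange, LorentzianMetric.isLocalDiffeomorph_of_isIsometricImmersion hE, hE.2⟩

/-- **The ♭ no-extremal-shadow condition is free on a sub-extremal Kerr d.o.c.**: re-identify any Kerr-looking presentation of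
`E.doc` by the element's own exact sub-extremal chart. [cite: DafermosLuk2017, Conjecture 1] -/
theorem noExtremalShadow_flat_of_isKerrDoc [Kerr.Facts] {𝓢 : Spacetime.{0} 4} (E : EndDatum 𝓢) {M a : ℝ} (hM : 0 < M)
    (ha : |a| < M) (h : IsKerrDoc 𝓢 E.doc M a) :
    ∀ M' a' : ℝ, 0 < M' → |a'| ≤ M' →
      (∃ Ψ : Kerr.exterior M' a' → 𝓢.carrier, Function.Injective Ψ ∧ Set.range Ψ = E.doc ∧
        PseudoRiemannianMetric.IsLocalIsometry
          (Kerr.smoothMetric M' a' (Kerr.rPlus M' a')).toPseudoRiemannianMetric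
          𝓢.metric.toPseudoRiemannianMetric Ψ) →
      ∃ M₂ a₂ : ℝ, 0 < M₂ ∧ |a₂| < M₂ ∧
        ∃ Ψ₂ : Kerr.exterior M₂ a₂ → 𝓢.carrier, Function.Injective Ψ₂ ∧ Set.range Ψ₂ = E.doc ∧
          PseudoRiemannianMetric.IsLocalIsometry
            (Kerr.smoothMetric M₂ a₂ (Kerr.rPlus M₂ a₂)).toPseudoRiemannianMetric
            𝓢.metric.toPseudoRiemannianMetric Ψ₂ :=
  fun _ _ _ _ _ ↦ ⟨M, a, hM, ha, kerrExterior_of_isKerrDoc h hM.le⟩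

/-- **No Kerr exterior of positive mass maps locally isometrically into a flat spacetime**: along the isometric immersion the
Kretschmann scalars agree (`Spacetime.kretschmannAt_comp_of_isIsometricImmersion`); Minkowski's vanishes (`IsMinkowski`,
`kretschmannAt_eq_zero_of_isMinkowski`) while Kerr's is `> 0` at an equatorial exterior point. O'Neill 1983, Ch. 3, Prop. 3.41;
Visser arXiv:0706.0622, §3. [cite: arXiv07060622, §3] -/
theorem not_kerrExterior_of_isMinkowski [Kerr.Facts] {𝓢 : Spacetime.{0} 4} (hflat : IsMinkowski 𝓢) {M a : ℝ} (hM : 0 < M)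
    {O : Set 𝓢.carrier} :
    ¬ ∃ Ψ : Kerr.exterior M a → 𝓢.carrier, Function.Injective Ψ ∧ Set.range Ψ = O ∧
      PseudoRiemannianMetric.IsLocalIsometry (Kerr.smoothMetric M a (Kerr.rPlus M a)).toPseudoRiemannianMetric
        𝓢.metric.toPseudoRiemannianMetric Ψ := by
  rintro ⟨Ψ, -, -, hΨ⟩
  set 𝓚 : Spacetime.{0} 4 := Kerr.spacetime M a (Kerr.rPlus M a) hM.le with h𝓚
  have hE : 𝓚.metric.IsIsometricImmersion 𝓢.metric.toPseudoRiemannianMetric Ψ := ⟨hΨ.1.contMDiff, hΨ.2⟩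
  obtain ⟨x, hx, hx3⟩ := TameHull.FlatEnd.exists_equatorial_mem_exterior M a
  have hcomp := Spacetime.kretschmannAt_comp_of_isIsometricImmersion (𝓢 := 𝓢) (𝓤 := 𝓚) hE ⟨x, hx⟩
  rw [kretschmannAt_eq_zero_of_isMinkowski hflat] at hcomp
  have hK : 𝓚.kretschmannAt ⟨x, hx⟩ = MetricCoord.rmNormSqAt (Kerr.bilin M a) x :=
    (Kerr.kretschmannAt_spacetime Kerr.kretschmannScalar_closedForm_holds M a (Kerr.rPlus M a) hM.le
      ⟨x, hx⟩).trans
      (Kerr.kretschmannScalar_closedForm_holds M a x (Kerr.radius_pos_of_mem_region hx)).symm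
  have hpos : 0 < MetricCoord.rmNormSqAt (Kerr.bilin M a) x :=
    Kerr.kretschmannScalar_equatorial_pos Kerr.kretschmannScalar_closedForm_holds hM.ne' a
      (Kerr.radius_pos_of_mem_region hx) hx3
  exact hpos.ne (hcomp.trans hK)

/-- **The ♭ no-extremal-shadow condition is free on flat elements** (its antecedent is empty by `not_kerrExterior_of_isMinkowski`).
[cite: arXiv07060622, §3] -/
theorem noExtremalShadow_flat_of_isMinkowski [Kerr.Facts] {𝓢 : Spacetime.{0} 4} (hflat : IsMinkowski 𝓢) (E : EndDatum 𝓢) :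
    ∀ M' a' : ℝ, 0 < M' → |a'| ≤ M' →
      (∃ Ψ : Kerr.exterior M' a' → 𝓢.carrier, Function.Injective Ψ ∧ Set.range Ψ = E.doc ∧
        PseudoRiemannianMetric.IsLocalIsometry
          (Kerr.smoothMetric M' a' (Kerr.rPlus M' a')).toPseudoRiemannianMetric
          𝓢.metric.toPseudoRiemannianMetric Ψ) →
      ∃ M₂ a₂ : ℝ, 0 < M₂ ∧ |a₂| < M₂ ∧
        ∃ Ψ₂ : Kerr.exterior M₂ a₂ → 𝓢.carrier, Function.Injective Ψ₂ ∧ Set.range Ψ₂ = E.doc ∧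
          PseudoRiemannianMetric.IsLocalIsometry
            (Kerr.smoothMetric M₂ a₂ (Kerr.rPlus M₂ a₂)).toPseudoRiemannianMetric
            𝓢.metric.toPseudoRiemannianMetric Ψ₂ :=
  fun _ _ hM' _ h ↦ absurd h (not_kerrExterior_of_isMinkowski hflat hM')

/-- **What N really asks (registered sub-goal `noExtremalShadow_flat_iff_classified_or` shape): on an element that is flat
or has a sub-extremal Kerr d.o.c., the ♭ condition holds.** [cite: DafermosLuk2017, Conjecture 1] -/
theorem noExtremalShadow_flat_of_classified : ∀ [Kerr.Facts] {𝓢 : Spacetime.{0} 4} (E : EndDatum 𝓢), (IsMinkowski 𝓢 ∨ ∃ M a : ℝ, 0 < M ∧ |a| < M ∧ IsKerrDoc 𝓢 E.doc M a) → ∀ M' a' : ℝ, 0 < M' → |a'| ≤ M' → (∃ Ψ : Kerr.exterior M' a' → 𝓢.carrier, Function.Injective Ψ ∧ Set.range Ψ = E.doc ∧ PseudoRiemannianMetric.IsLocalIsometry (Kerr.smoothMetric M' a' (Kerr.rPlus M' a')).toPseudoRiemannianMetric 𝓢.metric.toPseudoRiemannianMetric Ψ) → ∃ M₂ a₂ :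 ℝ, 0 < M₂ ∧ |a₂| < M₂ ∧ ∃ Ψ₂ : Kerr.exterior M₂ a₂ → 𝓢.carrier, Function.Injective Ψ₂ ∧ Set.range Ψ₂ = E.doc ∧ PseudoRiemannianMetric.IsLocalIsometry (Kerr.smoothMetric M₂ a₂ (Kerr.rPlus M₂ a₂)).toPseudoRiemannianMetric 𝓢.metric.toPseudoRiemannianMetric Ψ₂ := by
  intro _ 𝓢 E h
  rcases h with hflat | ⟨M, a, hM, ha, hK⟩
  · exact noExtremalShadow_flat_of_isMinkowski hflat E
  · exact noExtremalShadow_flat_of_isKerrDoc E hM ha hK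

end Summit.FinalStateConjecture.FinalStateConjecture.Theorems.TameLaSalle

end
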